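import Literature.MathematicalPhysics.QuantumFieldTheory.Balaban1983to89.T3SectALandauChart
import Literature.MathematicalPhysics.QuantumFieldTheory.Balaban1983to89.T4AdjointCovarianceUnitary
import HarnessLib

/-!
# Route `UnitScaleTilt`, crux K1 child «MinimiserStabilityRegPr» (stmt-QuantumFields-19200), registered stub `stub_prop7From14` (skeleton birth_v7
# cc37a178…; leaf V3) — THE SECT. C–E LETTERS OF THE v8 PRESENTATION `S_print` (pillar P-V3-CDE, CARD-19200-V3-g8 §3) AT THE T³ OBJECTS, AS A
# FUNCTION OF THE SECT. A LETTERS: the LOG-CHART reading of [Balaban1985Variational] (104)/(115), (111), (112)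

Cell `ym3-torus`, width seat `ym-ust-19200-w2` (gen 0; D-0149; OWNER W-SEAT START LIST 2026-08-27 22:29Z «w2 = P-V3-CDE»; OWNER RULING g23-№3 (α): one
convention throughout — every letter read on the torus objects ∕ x₀-based pullbacks; seat w1 types the Sect. A letters `IsAxial`, `Restricted`, `AvgCond`,
`IsLandau`, `CritL` of `sPrint` and leaves Sect. C–E as a parameter).  Route-posited objects (review lane); definitions only + their unfolding lemmas;
nothing here is a claim about the crux, d = 4 or the mass gap; YM₃ on T³ is a ladder rung (R3), not the Clay problem.

THE PRINT.  [Balaban1985Variational] p. 294: *«All critical configurations U₁ of the functional A(U₁U₀) in the space defined by (19)–(21), U₀ satisfies (14),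
can be obtained from solutions of Eq. (111) in the space (104) by the transformation U₁ = exp iη[A₁ + H₁B − HD(A₁ + H₁B)]. (112)»*; (104) *«|A₁| < 2ε₃(Lʲη)⁻¹,
|∇A₁| < 2ε₃(Lʲη)⁻²»*; (115) *«max{|A₁|₍₋₁₎, |∇A₁|₍₋₂₎} < ε₄»*; p. 296: *«by Propositions 5 and 6 there is at most one critical configuration of (5) in (19)–(21)»*;
pp. 296–299 (123)–(140): *«Thus the transformation (47) applied to A′₁ yields the configuration A′₁ − HD(A′₁) = (1/iη) log U₁ satisfying all the conditions
(19)–(21) with ε₂ = O(1)C₁B₃ε₁»*; (19) p. 281: *«U₁ = e^{iηA}, |A| < ε₂(Lʲη)⁻¹, |∇^η_{U₀}A| < ε₂(Lʲη)⁻², |D^{η*}_{U₀}D^η_{U₀}A|, |Δ^η_{U₀}A| < ε₂(Lʲη)⁻³ on Ω_j»*.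

DECLARED READINGS (cell DIVERGENCE style; each flagged; the Sect. A letters are whatever the argument `A` carries).
 (M1′) LOG COORDINATES.  The field variable of Sects. D–E («A₁», type `Fld = PBond → M₂(ℂ)` of `T3SectALandauChart.lgData3`) IS print's final exponent
       `X = ηA = η[A₁ + H₁B − HD(A₁ + H₁B)]` of (112): **`T112 V U₀ X := e^{iX}` bondwise** (`expHermField`; `SU(2)` for Hermitian traceless `X`, junk value `1`
       otherwise — documented); the intermediate variables `A′` of (47) and `A₁` of (101) and the operators `H`, `D`, `H₁`, `𝔊` of Sects. C–D are NOT constructed at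
       the T³ objects (as `B11Prop5Model` (M1) does not construct Prop. 3's change of variables).
 (M2′) (111) READ THROUGH PROP. 5'S OWN EQUIVALENCE: **`Sol111 V U₀ X := X ∈ 𝔰𝔲(2)-exponents ∧ (20) ∧ (21) ∧ «e^{iX} critical in (19)–(21)»`** (`A.AvgCond`,
       `A.IsLandau`, `A.CritL` BY NAME) — print proves «U₁ critical in (19)–(21) ⟺ U₁ = (112)(A₁) with A₁ solving (111)» (Prop. 5 + (112) + Prop. 3's range
       statement); we take the left side as the letter, so `Prop5Printed` becomes the tautological direction and `Prop6Printed` carries «exactly one critical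
       configuration of (5) in (19)–(21)» (p. 296) — print's Props 5 + 6 combined, the analytic content unchanged in total.
 (M3′) THE SIZE.  **`nMax U₀ X :=` the largest of the FOUR (19)-quantities** `‖X(b)‖/η`, `‖(∇¹_{U₀}X)_{μν}(x)‖/η²`, `‖(D¹*_{U₀}D¹_{U₀}X)_μ(x)‖/η³`, `‖(Δ¹_{U₀}X)_ν(x)‖/η³`
       (`T3SectALandauChart` §2 operators at `bgUnits U₀`, `η = L^{−(K−n)}`): print's (115) is the max of the FIRST TWO; its solution has all four by (123)–(140), and
       uniqueness over the smaller ball `{nMax < ε₄} ⊆ {max{|·|₍₋₁₎,|∇·|₍₋₂₎} < ε₄}` is WEAKER than print's — so `nMax X < ε ↔ X ∈ (19)(ε)` (`nMax19_lt_iff`).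
 (M4′) INERT LETTERS (precedent `B11Prop5Model` (M5), `B11Prop7ModelBridge`): Props 3–4 (`In43 … dVAnalytic`) are not hypotheses of the V3 knit; Prop. 6's second and
       third clauses («H₁B replaced by 𝔄», «analytic function of 𝔄») serve Sect. G ∕ Prop. 9 only: `LikeH1B := False` (no 𝔄 admitted), `Sol111G := False`,
       `SolAnalytic := True` — they carry NO claim; the owner may equally register P-V3-CDE with Prop. 6's first clause only.

WHAT IS DEFINED: `expHerm`, `expHermField` ((112) in log coordinates), `nMax19` ((19)/(115) size), **`tPrintOf A`** (the Sect. C–E override of a presentation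
`A : Resid F n K`), `tPrintFam` (member-wise).  PROVED (unfoldings): `coe_expHerm`, `expHerm_zero`, `expHermField_apply`, `nMax19_lt_iff`, `tPrintOf_*` field lemmas.

References: T. Bałaban, CMP 102 (1985) 277–309 [Balaban1985Variational] ((19)–(21) p.281, (104), (111)–(112) p.294, (115) p.295, p.296, (123)–(140) pp.296–299);
CMP 99 (1985) 75–102 [Balaban1985RegularSpaces] ((1.1)–(1.2) p.76, (1.36)–(1.39) pp.82–83).
-/

noncomputable section

namespace Summit.QuantumFields.YangMills.Theorems.Prop7TPrint

open Literature.MathematicalPhysics.QuantumFieldTheory.Balaban1983to89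
open Literature.MathematicalPhysics.QuantumFieldTheory.Balaban1983to89.T3ContinuumYM3Torus
open T4AdjointCovarianceUnitary (lieSU mem_lieSU_iff exp_mem_specialUnitaryGroup_of_mem_lieSU)
open T3Thm1Carrier
open T3SectALandauChart
open NormedSpace

open scoped Matrix.Norms.L2Operator

/-! ## §1 (112) in log coordinates: `X ↦ e^{iX}` into `SU(2)` -/

/-- `iY ∈ 𝔰𝔲(2)` for a Hermitian traceless `Y` (print's `A` is Hermitian: `U₁ = e^{iηA}` unitary). [cite: Balaban1985Variational, (19) p.281] -/
theorem I_smul_mem_lieSU {Y : Matrix (Fin 2) (Fin 2) ℂ} (h : Y.IsHermitian ∧ Y.trace = 0) : Complex.I • Y ∈ lieSU (Fin 2) := by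
  rw [mem_lieSU_iff]
  refine ⟨?_, ?_⟩
  · rw [star_smul, Complex.star_def, Complex.conj_I, Matrix.star_eq_conjTranspose, h.1.eq, neg_smul]
  · rw [Matrix.trace_smul, h.2, smul_zero]

/-- **`e^{iY} ∈ SU(2)`** for Hermitian traceless `Y ∈ M₂(ℂ)` — the bond value of (112)/(19) `U₁ = e^{iηA}`; for non-Hermitian or non-traceless `Y` the JUNK
value `1` (documented; every use is under the Hermitian-traceless clause of (19)). [cite: Balaban1985Variational, (112) p.294, (19) p.281] -/
def expHerm (Y : Matrix (Fin 2) (Fin 2) ℂ) : Matrix.specialUnitaryGroup (Fin 2) ℂ := by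
  classical
  exact if h : Y.IsHermitian ∧ Y.trace = 0 then ⟨exp (Complex.I • Y), exp_mem_specialUnitaryGroup_of_mem_lieSU (I_smul_mem_lieSU h)⟩ else 1

/-- `expHerm Y = e^{iY}` as a matrix, for Hermitian traceless `Y`. [cite: Balaban1985Variational, (112) p.294] -/
theorem coe_expHerm {Y : Matrix (Fin 2) (Fin 2) ℂ} (h : Y.IsHermitian ∧ Y.trace = 0) :
    ((expHerm Y : Matrix.specialUnitaryGroup (Fin 2) ℂ) : Matrix (Fin 2) (Fin 2) ℂ) = exp (Complex.I • Y) := by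
  classical
  unfold expHerm
  rw [dif_pos h]

/-- `expHerm 0 = 1`. [cite: Balaban1985Variational, (112) p.294] -/
theorem expHerm_zero : expHerm 0 = 1 := by
  apply Subtype.ext
  rw [coe_expHerm ⟨Matrix.isHermitian_zero, Matrix.trace_zero _ _⟩, smul_zero, exp_zero]
  rfl

variable {F : T3Family} {K : ℕ}

/-- **(112) IN LOG COORDINATES**: the configuration `U₁ = e^{iX}` of run `K`'s finest lattice from its exponent `X = ηA` (bondwise `expHerm`).
[cite: Balaban1985Variational, (112) p.294, (19) p.281] -/
def expHermField (X : PBond (F.P K) 0 → Matrix (Fin 2) (Fin 2) ℂ) : GaugeField (F.P K) 0 (Matrix.specialUnitaryGroup (Fin 2) ℂ) :=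
  fun b => expHerm (X b)

/-- Bond values of `expHermField`. [cite: Balaban1985Variational, (112) p.294] -/
theorem expHermField_apply (X : PBond (F.P K) 0 → Matrix (Fin 2) (Fin 2) ℂ) (b : PBond (F.P K) 0) : expHermField X b = expHerm (X b) := rfl

/-- `expHermField 0 = 1` (the trivial perturbation). [cite: Balaban1985Variational, (112) p.294] -/
theorem expHermField_zero : expHermField (F := F) (K := K) (fun _ => 0) = 1 := by
  funext b; rw [expHermField_apply, expHerm_zero]; rfl

/-! ## §2 The size (19)/(115): the largest of the four (19)-quantities -/

section Size

variable (F : T3Family) (n K : ℕ)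

/-- The bonds of a torus of the series form a non-empty finite set (`d ≥ 1`). [cite: Balaban1985Averaging, (5) p.18] -/
theorem univ_pbond_nonempty (P : Params) (j : ℕ) : (Finset.univ : Finset (PBond P j)).Nonempty :=
  ⟨⟨default, ⟨0, P.hd⟩⟩, Finset.mem_univ _⟩

/-- The index set of the gradient entries `(μ, ν, x)` is non-empty. [cite: Balaban1985RegularSpaces, (1.1) p.76] -/
theorem univ_grad_nonempty (P : Params) (j : ℕ) : (Finset.univ : Finset (Fin P.d × Fin P.d × Site P j)).Nonempty :=
  ⟨(⟨0, P.hd⟩, ⟨0, P.hd⟩, default), Finset.mem_univ _⟩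

/-- The index set of the one-form entries `(μ, x)` is non-empty. [cite: Balaban1985RegularSpaces, (1.2) p.76] -/
theorem univ_form_nonempty (P : Params) (j : ℕ) : (Finset.univ : Finset (Fin P.d × Site P j)).Nonempty :=
  ⟨(⟨0, P.hd⟩, default), Finset.mem_univ _⟩

/-- **THE SIZE OF AN EXPONENT `X = ηA` RELATIVE TO A BACKGROUND `U₀`** (reading (M3′)): the largest of the four quantities bounded in (19) —
`‖X(b)‖/η`, `‖(∇¹_{U₀}X)_{μν}(x)‖/η²`, `‖(D¹*_{U₀}D¹_{U₀}X)_μ(x)‖/η³`, `‖(Δ¹_{U₀}X)_ν(x)‖/η³` (`η = L^{−(K−n)}`, the covariant operators of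
`T3SectALandauChart` §2 at `bgUnits U₀`, operator norm on `M₂(ℂ)`) — so that `nMax19 U₀ X < ε` iff `X` satisfies the four bounds of (19) with `ε`
(`nMax19_lt_iff`); print's (115) `max{|A₁|₍₋₁₎, |∇A₁|₍₋₂₎}` is the max of the first two. [cite: Balaban1985Variational, (19) p.281, (115) p.295] -/
def nMax19 (U₀ : GaugeField (F.P K) 0 (Matrix.specialUnitaryGroup (Fin 2) ℂ)) (X : PBond (F.P K) 0 → Matrix (Fin 2) (Fin 2) ℂ) : ℝ :=
  max (max (Finset.univ.sup' (univ_pbond_nonempty (F.P K) 0) (fun b : PBond (F.P K) 0 => ‖X b‖ / eta F n K))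
        (Finset.univ.sup' (univ_grad_nonempty (F.P K) 0)
          (fun t : Fin (F.P K).d × Fin (F.P K).d × Site (F.P K) 0 => ‖covGradT 1 (bgUnits F K U₀) X t.1 t.2.1 t.2.2‖ / eta F n K ^ 2)))
    (max (Finset.univ.sup' (univ_form_nonempty (F.P K) 0)
          (fun t : Fin (F.P K).d × Site (F.P K) 0 => ‖covCodiffCurlT 1 (bgUnits F K U₀) X t.1 t.2‖ / eta F n K ^ 3))
        (Finset.univ.sup' (univ_form_nonempty (F.P K) 0)
          (fun t : Fin (F.P K).d × Site (F.P K) 0 => ‖covLapFormT 1 (bgUnits F K U₀) X t.1 t.2‖ / eta F n K ^ 3)))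

variable {F n K}

/-- **`nMax19 U₀ X < ε` IFF `X` SATISFIES THE FOUR BOUNDS OF (19) WITH `ε`** (the clauses 3–6 of `T3SectALandauChart.In19 ε U₀ · X`).
[cite: Balaban1985Variational, (19) p.281] -/
theorem nMax19_lt_iff {ε : ℝ} {U₀ : GaugeField (F.P K) 0 (Matrix.specialUnitaryGroup (Fin 2) ℂ)} {X : PBond (F.P K) 0 → Matrix (Fin 2) (Fin 2) ℂ} :
    nMax19 F n K U₀ X < ε ↔
      (∀ b : PBond (F.P K) 0, ‖X b‖ < ε * eta F n K) ∧
      (∀ (μ ν : Fin (F.P K).d) (x : Site (F.P K) 0), ‖covGradT 1 (bgUnits F K U₀) X μ ν x‖ < ε * eta F n K ^ 2) ∧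
      (∀ (μ : Fin (F.P K).d) (x : Site (F.P K) 0), ‖covCodiffCurlT 1 (bgUnits F K U₀) X μ x‖ < ε * eta F n K ^ 3) ∧
      (∀ (ν : Fin (F.P K).d) (x : Site (F.P K) 0), ‖covLapFormT 1 (bgUnits F K U₀) X ν x‖ < ε * eta F n K ^ 3) := by
  have hη : 0 < eta F n K := eta_pos F n K
  have hη2 : 0 < eta F n K ^ 2 := pow_pos hη 2
  have hη3 : 0 < eta F n K ^ 3 := pow_pos hη 3
  simp only [nMax19, max_lt_iff, Finset.sup'_lt_iff, Finset.mem_univ, forall_const, div_lt_iff₀ hη, div_lt_iff₀ hη2, div_lt_iff₀ hη3,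
    Prod.forall, and_assoc]

end Size

/-! ## §3 The Sect. C–E override `tPrintOf` of a presentation -/

section Override

variable {F : T3Family} {n K : ℕ}

/-- **THE SECT. C–E LETTERS OF THE v8 PRESENTATION, AS A FUNCTION OF THE SECT. A LETTERS** (readings (M1′)–(M4′) of the module docstring): the
presentation `A` with `nMax := nMax19`, `T112 V U₀ X := e^{iX}`, `Sol111 V U₀ X := (X Hermitian traceless bondwise) ∧ A.AvgCond V U₀ X ∧ A.IsLandau U₀ X ∧
A.CritL V U₀ (e^{iX})`, and the letters not consumed by the Prop.-7 knit inert (`In43`, `Def47`, `dVAnalytic`, `SolAnalytic := True`; `nM1`, `normD`, `kerD`,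
`dVn := 0`; `T47 := id`; `LikeH1B`, `Sol111G := False`).  The Sect. A letters `IsAxial`, `Restricted`, `AvgCond`, `IsLandau`, `CritL` are `A`'s, untouched.
[cite: Balaban1985Variational, (104), (111)-(112) p.294, (115) p.295, (19)-(21) p.281] -/
def tPrintOf (A : Resid F n K) : Resid F n K :=
  { A with
    In43 := fun _ _ _ => True
    nM1 := fun _ _ => 0
    Def47 := fun _ _ => True
    T47 := fun _ X => X
    normD := fun _ _ => 0
    kerD := fun _ _ _ _ => 0
    nMax := fun U₀ X => nMax19 F n K U₀ X
    dVn := fun _ _ => 0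
    dVAnalytic := fun _ _ => True
    Sol111 := fun V U₀ X => (∀ b : PBond (F.P K) 0, (X b).IsHermitian ∧ Matrix.trace (X b) = 0) ∧ A.AvgCond V U₀ X ∧ A.IsLandau U₀ X ∧
      A.CritL V U₀ (expHermField X)
    T112 := fun _ _ X => expHermField X
    LikeH1B := fun _ _ _ => False
    Sol111G := fun _ _ _ => False
    SolAnalytic := fun _ _ _ => True }

variable (A : Resid F n K)

/-- `tPrintOf` keeps `IsAxial`. [cite: Balaban1985Variational, (18) p.280] -/
@[simp] theorem tPrintOf_isAxial : (tPrintOf A).IsAxial = A.IsAxial := rfl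
/-- `tPrintOf` keeps `Restricted`. [cite: Balaban1985RegularSpaces, (1.29) p.81] -/
@[simp] theorem tPrintOf_restricted : (tPrintOf A).Restricted = A.Restricted := rfl
/-- `tPrintOf` keeps `AvgCond`. [cite: Balaban1985Variational, (20) p.281] -/
@[simp] theorem tPrintOf_avgCond : (tPrintOf A).AvgCond = A.AvgCond := rfl
/-- `tPrintOf` keeps `IsLandau`. [cite: Balaban1985Variational, (21) p.281] -/
@[simp] theorem tPrintOf_isLandau : (tPrintOf A).IsLandau = A.IsLandau := rfl
/-- `tPrintOf` keeps `CritL`. [cite: Balaban1985Variational, Prop. 2 p.281] -/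
@[simp] theorem tPrintOf_critL : (tPrintOf A).CritL = A.CritL := rfl
/-- `nMax` of `tPrintOf A` is `nMax19`. [cite: Balaban1985Variational, (115) p.295] -/
@[simp] theorem tPrintOf_nMax (U₀ : GaugeField (F.P K) 0 (Matrix.specialUnitaryGroup (Fin 2) ℂ)) (X : PBond (F.P K) 0 → Matrix (Fin 2) (Fin 2) ℂ) :
    (tPrintOf A).nMax U₀ X = nMax19 F n K U₀ X := rfl
/-- `T112` of `tPrintOf A` is `e^{iX}`. [cite: Balaban1985Variational, (112) p.294] -/
@[simp] theorem tPrintOf_T112 (V : GaugeField (F.P n) 0 (Matrix.specialUnitaryGroup (Fin 2) ℂ))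
    (U₀ : GaugeField (F.P K) 0 (Matrix.specialUnitaryGroup (Fin 2) ℂ)) (X : PBond (F.P K) 0 → Matrix (Fin 2) (Fin 2) ℂ) :
    (tPrintOf A).T112 V U₀ X = expHermField X := rfl
/-- `Sol111` of `tPrintOf A` is «Hermitian traceless ∧ (20) ∧ (21) ∧ critical in (19)–(21)». [cite: Balaban1985Variational, (111) p.294, Prop. 5 p.294] -/
theorem tPrintOf_sol111_iff (V : GaugeField (F.P n) 0 (Matrix.specialUnitaryGroup (Fin 2) ℂ))
    (U₀ : GaugeField (F.P K) 0 (Matrix.specialUnitaryGroup (Fin 2) ℂ)) (X : PBond (F.P K) 0 → Matrix (Fin 2) (Fin 2) ℂ) :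
    (tPrintOf A).Sol111 V U₀ X ↔ (∀ b : PBond (F.P K) 0, (X b).IsHermitian ∧ Matrix.trace (X b) = 0) ∧ A.AvgCond V U₀ X ∧ A.IsLandau U₀ X ∧
      A.CritL V U₀ (expHermField X) := Iff.rfl
/-- `LikeH1B` of `tPrintOf A` admits no `𝔄` (inert, (M4′)). [cite: Balaban1985Variational, Prop. 6 p.295] -/
@[simp] theorem tPrintOf_likeH1B (ε₁ : ℝ) (U₀ : GaugeField (F.P K) 0 (Matrix.specialUnitaryGroup (Fin 2) ℂ)) (𝔄 : PBond (F.P K) 0 → Matrix (Fin 2) (Fin 2) ℂ) :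
    (tPrintOf A).LikeH1B ε₁ U₀ 𝔄 ↔ False := Iff.rfl
/-- `SolAnalytic` of `tPrintOf A` is inert ((M4′)). [cite: Balaban1985Variational, Prop. 6 p.295] -/
@[simp] theorem tPrintOf_solAnalytic (U₀ : GaugeField (F.P K) 0 (Matrix.specialUnitaryGroup (Fin 2) ℂ)) (ε₁ ε₄ : ℝ) :
    (tPrintOf A).SolAnalytic U₀ ε₁ ε₄ ↔ True := Iff.rfl

end Override

/-- **THE FAMILY VERSION**: the Sect. C–E override member by member (so `S_v8 := tPrintFam (sPrint L T)` = seat w1's Sect. A letters + these Sect. C–E letters).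
[cite: Balaban1985Variational, (104), (111)-(112) p.294, (115) p.295] -/
def tPrintFam {L : ℕ} (A : ResidFam L) : ResidFam L := fun i => tPrintOf (A i)

/-- Members of `tPrintFam`. [cite: Balaban1985Variational, (111)-(112) p.294] -/
@[simp] theorem tPrintFam_apply {L : ℕ} (A : ResidFam L) (i : Idx L) : tPrintFam A i = tPrintOf (A i) := rfl

end Summit.QuantumFields.YangMills.Theorems.Prop7TPrint

end
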